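import Summits.Ventures.GridStability.Models.NE39LFaultOnBus8

/-!
# NE39LFaultOnBus8TubeLegsC — shard C of the 40-leg kernel tube of «NE39L Padiyar Table 4.1 case 2: bus 8 grounded, no line tripped»: legs 27 … 39 (τ = 1/200 s, t ∈ [0.135, 0.2] s)

Venture GRIDFUSION (G1-cct next wave «G1cct-NE39-TUBE», lead g8 RULINGs 9aa (3) / 9ar (1) / 9as; seat gridfusion-model-1 g8).  PROOF-ONLY file (the legs,
the data and the boxes are the literals of `Models/NE39LFaultOnBus8.lean`): ONE `decide` each — the generic chain check `SwingTube.chainOK` (interval field bounds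
with the monotonicity-aware term enclosures on every leg box, Moore's four strict inclusions at every restart; exact Python mirror = True) passes on
`b8legsC` from the shard's start box `b8K27`, and the box reached is the literal `b8K40`.  Assembled in `NE39LFaultOnBus8Tube.lean` (`SwingTube.chainOK_append`).
MODELLED: fault-on model M′_F `NE39L.FaultBus8.model`; CERTIFIED: the two identities below; no stability claim.  [cite: Moore1979, §8.1 eqs. (8.5), (8.10)]
-/

namespace Summit.Ventures.GridStability.Models

namespace NE39L

namespace FaultBus8

/-- **KERNEL: the chain check of shard C (legs 27 … 39) passes from `b8K27`.** -/
theorem legsC_chainOK : SwingTube.chainOK bus8Q b8K27 b8legsC = true := by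
  decide +kernel

/-- **KERNEL: the box reached by shard C is the literal `b8K40`.** -/
theorem kboxAt_legsC : SwingTube.kboxAt b8K27 b8legsC 13 = b8K40 :=
  SwingTube.KBox.eq_of_forall (by decide +kernel)

end FaultBus8

end NE39L

end Summit.Ventures.GridStability.Models
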